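import Literature.NumberTheory.Rogawski1990.ArchCentralLimitCompactWallReduction   -- ★ p843372 + ED. 2 p843405 ((A4)-R, both sides)
import Literature.NumberTheory.Automorphic.ArchTorusOrbitalWeyl                     -- ★ `integral_comp_conj_circleDiagonal_comp_perm` (Weyl invariance at one place)
import Literature.NumberTheory.Automorphic.ArchLocalTorusOrbitalBlockSmooth         -- ★ p842196 (A1) `contDiffOn_integral_comp_conj_circleDiagonal_angles_of_blocks`
import HarnessLib

/-!
# The compact-wall reduction AT THE ORBITAL INTEGRAL of `U(2,1)`

Rogawski, *Automorphic representations of unitary groups in three variables* (1990), §8.4 pp. 126–127.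
★ `ArchCentralLimitCompactWallReduction` reduces the corner value `Λ₈^∠[H](0)` of a chamber extension
`H` (compact-adjacent chamber) to three numbers of the `|1 − w|²`-normalised wall germs, for an ABSTRACT
`Φ : (S¹)³ → ℂ` which is (i) invariant under the compact Weyl reflection `(0 1)` and (ii) `C³` in the angle
chart on an open set containing the punctured compact wall.  This file DISCHARGES (i) and (ii) for the
letter's orbital integral
  `Φ_Θ(z) = ∫_{G_w} Θ(↑↑(g·t(z)·g⁻¹)) dν(g)`,  `G_w = U(σ_w diag α)(ℂ)` with `0 < re σ_wα₀ · re σ_wα₁`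
(the pair `{0,1}` compact), `ν` right-invariant and finite on compacta, `Θ` smooth with compact support on
`G_w`: (i) is ★ `integral_comp_conj_circleDiagonal_comp_perm` (the reflection is a Weyl move of `G_w`),
(ii) is ★ ROAD A (A1) `contDiffOn_integral_comp_conj_circleDiagonal_angles_of_blocks` with the block
labelling `b = (c, c, d)` (smooth off the NONCOMPACT walls `{z₀ = z₂} ∪ {z₁ = z₂}`, hence across the compact
wall), and the wall points `t·A⃗ = (t, t, −2t)`, `0 < |t| ≤ 2`, lie off the noncompact walls.  It also
supplies the closure facts `t·A⃗ ∈ closure C_σ` for the four compact-adjacent chambers.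

Net statement (`lambda8Angle_cornerExtension_eq_of_orbital_compactWallGerms[_neg]`): for such data, a
chamber `C` with the wall points in its closure, a `C³` corner extension `H` of `F_Θ = (ρ′Δ·Φ_Θ)∘chart_ζ`
from `U ∩ C` (the (A6) input), and the germs `ψ = m·Φ_Θ(k_·)`, `χ = m²·N²Φ_Θ(k_·)` of class `C²` on
`[0, δ]` (the (A3) input):
  `Λ₈^∠[H](0) = −(2/3)i·ψ″(0⁺) − (1/2)i·ψ(0) + (1/12)i·χ″(0⁺)`.
-/

open Filter Topology Set Complex MeasureTheory
open scoped ContDiff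
open scoped Matrix MatrixGroups Matrix.Norms.Operator
open Literature.NumberTheory.Automorphic.UnitaryGroup

namespace Literature.NumberTheory.Rogawski1990

/-! ## §1 Geometry of the wall points `t·A⃗` -/

section WallPoints

/-- `Circle.exp a ≠ Circle.exp b` when `a ≠ b` and `|a − b| < 2π`. [cite: Rogawski1990, §8.4 p. 126] -/
theorem circleExp_ne_of_abs_sub_lt_two_pi {a b : ℝ} (hab : a ≠ b) (hsmall : |a - b| < 2 * Real.pi) : Circle.exp a ≠ Circle.exp b := by
  intro h
  obtain ⟨m, hm⟩ := Circle.exp_eq_exp.1 h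
  have hm' : a - b = m * (2 * Real.pi) := by linarith
  by_cases hm0 : (m : ℝ) = 0
  · exact hab (by linarith [show a - b = 0 by rw [hm', hm0, zero_mul]])
  · have hm1 : (1 : ℝ) ≤ |(m : ℝ)| := by
      have : m ≠ 0 := by exact_mod_cast hm0
      exact_mod_cast Int.one_le_abs this
    have : 2 * Real.pi ≤ |a - b| := by
      rw [hm', abs_mul, abs_of_pos Real.two_pi_pos]
      nlinarith [Real.pi_pos]
    linarith

/-- The wall points `ζ·e^{itA⃗}`, `A⃗ = (1,1,−2)`, `t ≠ 0`, `|t| ≤ 2`, lie OFF the noncompact walls: `z₀ ≠ z₂` and `z₁ ≠ z₂`.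
[cite: Rogawski1990, §8.4 p. 126] -/
theorem wallPoint_off_noncompact_walls (ζ : Circle) {t : ℝ} (ht : t ≠ 0) (ht2 : |t| ≤ 2) :
    ζ * Circle.exp ((t • (![1, 1, -2] : Fin 3 → ℝ)) 0) ≠ ζ * Circle.exp ((t • (![1, 1, -2] : Fin 3 → ℝ)) 2) ∧
      ζ * Circle.exp ((t • (![1, 1, -2] : Fin 3 → ℝ)) 1) ≠ ζ * Circle.exp ((t • (![1, 1, -2] : Fin 3 → ℝ)) 2) := by
  have h3 : |t - t * -2| < 2 * Real.pi := by
    have : t - t * -2 = 3 * t := by ring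
    rw [this, abs_mul, abs_of_pos (by norm_num : (0 : ℝ) < 3)]
    nlinarith [Real.pi_gt_three, abs_nonneg t]
  have hne : t ≠ t * -2 := by
    intro h
    apply ht
    linarith
  have key := circleExp_ne_of_abs_sub_lt_two_pi hne h3
  constructor <;>
  · simp only [Pi.smul_apply, smul_eq_mul, Matrix.cons_val_zero, Matrix.cons_val_one, Matrix.cons_val_two, Matrix.tail_cons,
      Matrix.head_cons, mul_one, ne_eq]
    intro h
    exact key (mul_left_cancel h)

/-- Closure facts, side `t > 0`: `t·A⃗ = (t,t,−2t)` is in the closure of the chambers `{θ₂ < θ₀ < θ₁}` and `{θ₂ < θ₁ < θ₀}`.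
[cite: Rogawski1990, §8.4 p. 126] -/
theorem wallPoint_mem_closure_chamber_pos {t : ℝ} (ht : 0 < t) :
    t • (![1, 1, -2] : Fin 3 → ℝ) ∈ closure {θ : Fin 3 → ℝ | θ 2 < θ 0 ∧ θ 0 < θ 1} ∧
      t • (![1, 1, -2] : Fin 3 → ℝ) ∈ closure {θ : Fin 3 → ℝ | θ 2 < θ 1 ∧ θ 1 < θ 0} := by
  have hlim : ∀ v : Fin 3 → ℝ, Tendsto (fun ε : ℝ => t • (![1, 1, -2] : Fin 3 → ℝ) + ε • v) (𝓝[>] 0) (𝓝 (t • (![1, 1, -2] : Fin 3 → ℝ))) := by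
    intro v
    have hc : Continuous fun ε : ℝ => t • (![1, 1, -2] : Fin 3 → ℝ) + ε • v := by fun_prop
    simpa only [zero_smul, add_zero] using (hc.tendsto 0).mono_left nhdsWithin_le_nhds
  have hsmall : ∀ᶠ ε : ℝ in 𝓝[>] 0, ε ∈ Ioo 0 (3 * t) := Ioo_mem_nhdsGT (by linarith)
  constructor
  · refine mem_closure_of_tendsto (hlim ![-1, 1, 0]) ?_
    filter_upwards [hsmall] with ε hε
    simp only [Pi.add_apply, Pi.smul_apply, smul_eq_mul, Matrix.cons_val_zero, Matrix.cons_val_one, Matrix.cons_val_two,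
      Matrix.tail_cons, Matrix.head_cons]
    constructor <;> nlinarith [hε.1, hε.2]
  · refine mem_closure_of_tendsto (hlim ![1, -1, 0]) ?_
    filter_upwards [hsmall] with ε hε
    simp only [Pi.add_apply, Pi.smul_apply, smul_eq_mul, Matrix.cons_val_zero, Matrix.cons_val_one, Matrix.cons_val_two,
      Matrix.tail_cons, Matrix.head_cons]
    constructor <;> nlinarith [hε.1, hε.2]

/-- Closure facts, side `t < 0`: `(−u)·A⃗ = (−u,−u,2u)` is in the closure of the chambers `{θ₀ < θ₁ < θ₂}` and `{θ₁ < θ₀ < θ₂}`.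
[cite: Rogawski1990, §8.4 p. 126] -/
theorem wallPoint_mem_closure_chamber_neg {u : ℝ} (hu : 0 < u) :
    (-u) • (![1, 1, -2] : Fin 3 → ℝ) ∈ closure {θ : Fin 3 → ℝ | θ 0 < θ 1 ∧ θ 1 < θ 2} ∧
      (-u) • (![1, 1, -2] : Fin 3 → ℝ) ∈ closure {θ : Fin 3 → ℝ | θ 1 < θ 0 ∧ θ 0 < θ 2} := by
  have hlim : ∀ v : Fin 3 → ℝ, Tendsto (fun ε : ℝ => (-u) • (![1, 1, -2] : Fin 3 → ℝ) + ε • v) (𝓝[>] 0) (𝓝 ((-u) • (![1, 1, -2] : Fin 3 → ℝ))) := by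
    intro v
    have hc : Continuous fun ε : ℝ => (-u) • (![1, 1, -2] : Fin 3 → ℝ) + ε • v := by fun_prop
    simpa only [zero_smul, add_zero] using (hc.tendsto 0).mono_left nhdsWithin_le_nhds
  have hsmall : ∀ᶠ ε : ℝ in 𝓝[>] 0, ε ∈ Ioo 0 (3 * u) := Ioo_mem_nhdsGT (by linarith)
  constructor
  · refine mem_closure_of_tendsto (hlim ![-1, 1, 0]) ?_
    filter_upwards [hsmall] with ε hε
    simp only [Pi.add_apply, Pi.smul_apply, smul_eq_mul, Matrix.cons_val_zero, Matrix.cons_val_one, Matrix.cons_val_two,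
      Matrix.tail_cons, Matrix.head_cons]
    constructor <;> nlinarith [hε.1, hε.2]
  · refine mem_closure_of_tendsto (hlim ![1, -1, 0]) ?_
    filter_upwards [hsmall] with ε hε
    simp only [Pi.add_apply, Pi.smul_apply, smul_eq_mul, Matrix.cons_val_zero, Matrix.cons_val_one, Matrix.cons_val_two,
      Matrix.tail_cons, Matrix.head_cons]
    constructor <;> nlinarith [hε.1, hε.2]

/-- A point of `U` in the closure of `C` is in the closure of `U ∩ C` (`U` open). [cite: Rogawski1990, §8.4 p. 126] -/
theorem mem_closure_inter_of_isOpen {X : Type*} [TopologicalSpace X] {U C : Set X} (hU : IsOpen U) {x : X} (hxU : x ∈ U)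
    (hxC : x ∈ closure C) : x ∈ closure (U ∩ C) :=
  hU.inter_closure ⟨hxU, hxC⟩

end WallPoints

/-! ## §2 The orbital integral: Weyl evenness and smoothness off the noncompact walls -/

section Orbital

variable (L : Type) [Field L] (α : Fin 3 → L) (w : {w : NumberField.InfinitePlace L // NumberField.InfinitePlace.IsComplex w})
  [MeasurableSpace (archLocal L 3 (Matrix.diagonal α) w)] [BorelSpace (archLocal L 3 (Matrix.diagonal α) w)]

/-- **The orbital integral is EVEN under the compact Weyl reflection `(0 1)`** (`0 < re σ_wα₀·re σ_wα₁`): a Weyl move of `G_w` and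
right-invariance of `ν` (★ `integral_comp_conj_circleDiagonal_comp_perm`). [cite: Rogawski1990, §8.2 p. 122; §8.4 p. 126] -/
theorem orbital_comp_swap01_eq (hα : ∀ i, α i ≠ 0) (hreal : ∀ i, (w.1.embedding (α i)).im = 0)
    (hcpt : 0 < (w.1.embedding (α 0)).re * (w.1.embedding (α 1)).re)
    (ν : Measure (archLocal L 3 (Matrix.diagonal α) w)) [ν.IsMulRightInvariant] (Θ : Matrix (Fin 3) (Fin 3) ℂ → ℂ) (z : Fin 3 → Circle) :
    (∫ g, Θ (((g * ⟨circleDiagonal 3 (z ∘ (Equiv.swap (0 : Fin 3) 1)), circleDiagonal_mem_archLocal_diagonal L 3 α w _⟩ * g⁻¹ :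
        archLocal L 3 (Matrix.diagonal α) w) : GL (Fin 3) ℂ) : Matrix (Fin 3) (Fin 3) ℂ) ∂ν) =
      ∫ g, Θ (((g * ⟨circleDiagonal 3 z, circleDiagonal_mem_archLocal_diagonal L 3 α w _⟩ * g⁻¹ :
        archLocal L 3 (Matrix.diagonal α) w) : GL (Fin 3) ℂ) : Matrix (Fin 3) (Fin 3) ℂ) ∂ν :=
  by
  have h01 : 0 < (w.1.embedding (α 0)).re ↔ 0 < (w.1.embedding (α 1)).re := by
    rcases mul_pos_iff.1 hcpt with ⟨h0, h1⟩ | ⟨h0, h1⟩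
    · exact ⟨fun _ => h1, fun _ => h0⟩
    · exact ⟨fun h => absurd h (not_lt.2 h0.le), fun h => absurd h (not_lt.2 h1.le)⟩
  have hsign : ∀ k : Fin 3, 0 < (w.1.embedding (α ((Equiv.swap (0 : Fin 3) 1) k))).re ↔ 0 < (w.1.embedding (α k)).re := by
    intro k
    fin_cases k
    · simpa using h01.symm
    · simpa using h01
    · simp [Equiv.swap_apply_of_ne_of_ne]
  exact integral_comp_conj_circleDiagonal_comp_perm L 3 α w hα hreal hsign z ν
    (fun x : archLocal L 3 (Matrix.diagonal α) w => Θ ((x : GL (Fin 3) ℂ) : Matrix (Fin 3) (Fin 3) ℂ))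

/-- **The orbital integral is `C^∞` in the angles off the NONCOMPACT walls** `{z₀ = z₂} ∪ {z₁ = z₂}` (★ ROAD A (A1) with the block labelling
`b = (c, c, d)`), in particular across the compact wall `{z₀ = z₁}`. [cite: Rogawski1990, §8.4 p. 126] [cite: Varadarajan1989, §6.4] -/
theorem contDiffOn_orbital_angleChart_off_noncompact_walls (hα : ∀ i, α i ≠ 0) (hreal : ∀ i, (w.1.embedding (α i)).im = 0)
    (hcpt : 0 < (w.1.embedding (α 0)).re * (w.1.embedding (α 1)).re)
    (ν : Measure (archLocal L 3 (Matrix.diagonal α) w)) [IsFiniteMeasureOnCompacts ν] (Θ : Matrix (Fin 3) (Fin 3) ℂ → ℂ)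
    (hΘ : ContDiff ℝ ∞ Θ) (hΘc : HasCompactSupport fun k : archLocal L 3 (Matrix.diagonal α) w => Θ ((k : GL (Fin 3) ℂ) : Matrix (Fin 3) (Fin 3) ℂ))
    (ζ : Circle) :
    ContDiffOn ℝ ∞ (fun θ : Fin 3 → ℝ => ∫ g, Θ (((g * ⟨circleDiagonal 3 (fun k => ζ * Circle.exp (θ k)), circleDiagonal_mem_archLocal_diagonal L 3 α w _⟩ * g⁻¹ :
        archLocal L 3 (Matrix.diagonal α) w) : GL (Fin 3) ℂ) : Matrix (Fin 3) (Fin 3) ℂ) ∂ν)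
      {θ : Fin 3 → ℝ | ζ * Circle.exp (θ 0) ≠ ζ * Circle.exp (θ 2) ∧ ζ * Circle.exp (θ 1) ≠ ζ * Circle.exp (θ 2)} := by
  have hsign : ∀ i j : Fin 3, i ≠ j → (![true, true, false] : Fin 3 → Bool) i = (![true, true, false] : Fin 3 → Bool) j →
      0 < (w.1.embedding (α i)).re * (w.1.embedding (α j)).re := by
    intro i j hij hb
    fin_cases i <;> fin_cases j <;> first | exact absurd rfl hij | exact hcpt | (rw [mul_comm]; exact hcpt) | simp at hb
  have h := contDiffOn_integral_comp_conj_circleDiagonal_angles_of_blocks L 3 α w hα hreal (![true, true, false] : Fin 3 → Bool) hsign ν Θ hΘ hΘc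
    (fun _ : Fin 3 => ζ)
  refine h.mono fun θ hθ => ?_
  intro i j hb
  fin_cases i <;> fin_cases j <;> simp_all [eq_comm]

/-- The set of angles off the noncompact walls is open. [cite: Rogawski1990, §8.4 p. 126] -/
theorem isOpen_setOf_off_noncompact_walls (ζ : Circle) :
    IsOpen {θ : Fin 3 → ℝ | ζ * Circle.exp (θ 0) ≠ ζ * Circle.exp (θ 2) ∧ ζ * Circle.exp (θ 1) ≠ ζ * Circle.exp (θ 2)} := by
  have hc : ∀ k : Fin 3, Continuous fun θ : Fin 3 → ℝ => ζ * Circle.exp (θ k) := fun k =>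
    continuous_const.mul (Circle.exp.continuous.comp (continuous_apply k))
  exact (isOpen_ne_fun (hc 0) (hc 2)).inter (isOpen_ne_fun (hc 1) (hc 2))

end Orbital

/-! ## §3 The reduction at the orbital integral -/

section Main

variable (L : Type) [Field L] (α : Fin 3 → L) (w : {w : NumberField.InfinitePlace L // NumberField.InfinitePlace.IsComplex w})
  [MeasurableSpace (archLocal L 3 (Matrix.diagonal α) w)] [BorelSpace (archLocal L 3 (Matrix.diagonal α) w)]

/-- **THE COMPACT-WALL REDUCTION AT THE ORBITAL INTEGRAL, side `t > 0`** (chambers `{θ₂<θ₀<θ₁}`, `{θ₂<θ₁<θ₀}`, i.e. any open `C` with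
`t·A⃗ ∈ closure C` for `t ∈ (0, δ)`).  Data: the compact pair `0 < re σ_wα₀·re σ_wα₁`; `ν` right-invariant, finite on compacta; `Θ` smooth with compact
support on `G_w`; `Φ` THE ORBITAL INTEGRAL (`hΦ`); `H` a `C³` corner extension on `U ∋ 0` of `F_Θ = (ρ′Δ·Φ)∘chart_ζ` from `U ∩ C` ((A6)); `0 < δ ≤ 2` with `t·A⃗ ∈ U`
for `t ∈ (0, δ)`; germs `ψ = m·Φ(k_·)`, `χ = m²·N²Φ(k_·)` of class `C²` on `[0, δ]` ((A3)).  THEN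
`Λ₈^∠[H](0) = −(2/3)i·ψ″(0⁺) − (1/2)i·ψ(0) + (1/12)i·χ″(0⁺)`, `12ψ(0) = 6χ(0)`, `12ψ′(0⁺) = 6χ′(0⁺)`.
[cite: Rogawski1990, §8.4 pp. 126–127] [cite: Varadarajan1989, §6.4] -/
theorem lambda8Angle_cornerExtension_eq_of_orbital_compactWallGerms (hα : ∀ i, α i ≠ 0) (hreal : ∀ i, (w.1.embedding (α i)).im = 0)
    (hcpt : 0 < (w.1.embedding (α 0)).re * (w.1.embedding (α 1)).re)
    (ν : Measure (archLocal L 3 (Matrix.diagonal α) w)) [IsFiniteMeasureOnCompacts ν] [ν.IsMulRightInvariant]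
    (Θ : Matrix (Fin 3) (Fin 3) ℂ → ℂ) (hΘ : ContDiff ℝ ∞ Θ)
    (hΘc : HasCompactSupport fun k : archLocal L 3 (Matrix.diagonal α) w => Θ ((k : GL (Fin 3) ℂ) : Matrix (Fin 3) (Fin 3) ℂ))
    (ζ : Circle) (Φ : (Fin 3 → Circle) → ℂ)
    (hΦ : Φ = fun z => ∫ g, Θ (((g * ⟨circleDiagonal 3 z, circleDiagonal_mem_archLocal_diagonal L 3 α w z⟩ * g⁻¹ :
        archLocal L 3 (Matrix.diagonal α) w) : GL (Fin 3) ℂ) : Matrix (Fin 3) (Fin 3) ℂ) ∂ν)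
    {C U : Set (Fin 3 → ℝ)} (hC : IsOpen C) (hU : IsOpen U) (h0 : (0 : Fin 3 → ℝ) ∈ U)
    {H : (Fin 3 → ℝ) → ℂ} (hH : ContDiffOn ℝ 3 H U)
    (hHF : ∀ θ ∈ U, θ ∈ C → H θ =
      (((ζ * Circle.exp (θ 0) : Circle) : ℂ)) * ((((ζ * Circle.exp (θ 2) : Circle) : ℂ)))⁻¹ *
        ((1 - (((ζ * Circle.exp (θ 1) : Circle) : ℂ)) * ((((ζ * Circle.exp (θ 0) : Circle) : ℂ)))⁻¹) *
          (1 - (((ζ * Circle.exp (θ 2) : Circle) : ℂ)) * ((((ζ * Circle.exp (θ 1) : Circle) : ℂ)))⁻¹) *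
          (1 - (((ζ * Circle.exp (θ 2) : Circle) : ℂ)) * ((((ζ * Circle.exp (θ 0) : Circle) : ℂ)))⁻¹)) *
        Φ (fun j => ζ * Circle.exp (θ j)))
    {δ : ℝ} (hδ : 0 < δ) (hδ2 : δ ≤ 2)
    (hwall : ∀ t ∈ Ioo 0 δ, t • (![1, 1, -2] : Fin 3 → ℝ) ∈ U ∧ t • (![1, 1, -2] : Fin 3 → ℝ) ∈ closure C)
    {ψ χ : ℝ → ℂ} (hψ : ContDiffOn ℝ 2 ψ (Icc 0 δ)) (hχ : ContDiffOn ℝ 2 χ (Icc 0 δ))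
    (hψdef : ∀ t ∈ Ioo 0 δ, ψ t = ((2 - 2 * Real.cos (3 * t) : ℝ) : ℂ) * Φ (fun j => ζ * Circle.exp ((t • (![1, 1, -2] : Fin 3 → ℝ)) j)))
    (hχdef : ∀ t ∈ Ioo 0 δ, χ t = ((2 - 2 * Real.cos (3 * t) : ℝ) : ℂ) ^ 2 *
      iteratedDeriv 2 (fun s : ℝ => Φ (fun j => (fun i : Fin 3 => ζ * Circle.exp ((t • (![1, 1, -2] : Fin 3 → ℝ)) i)) j *
        Circle.exp (s * (![1, -1, 0] : Fin 3 → ℝ) j))) 0) :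
    (1 / 48 : ℂ) * ∑ ε : Fin 3 → Bool, ((((if ε 0 then (1 : ℝ) else -1) * (if ε 1 then (1 : ℝ) else -1) * (if ε 2 then (1 : ℝ) else -1) : ℝ)) : ℂ) *
        iteratedDeriv 3 (fun s : ℝ => H (s • (![(if ε 0 then (1 : ℝ) else -1) + (if ε 1 then (1 : ℝ) else -1), -(if ε 0 then (1 : ℝ) else -1) + (if ε 2 then (1 : ℝ) else -1),
          -(if ε 1 then (1 : ℝ) else -1) - (if ε 2 then (1 : ℝ) else -1)]))) 0 =
        -(2 / 3) * I * iteratedDerivWithin 2 ψ (Icc 0 δ) 0 - (1 / 2) * I * ψ 0 + (1 / 12) * I * iteratedDerivWithin 2 χ (Icc 0 δ) 0 ∧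
      12 * ψ 0 = 6 * χ 0 ∧ 12 * derivWithin ψ (Icc 0 δ) 0 = 6 * derivWithin χ (Icc 0 δ) 0 := by
  -- (i) Weyl evenness and (ii) smoothness off the noncompact walls, for the orbital integral
  have hΦsymm : ∀ z : Fin 3 → Circle, Φ (z ∘ (Equiv.swap (0 : Fin 3) 1)) = Φ z := by
    intro z
    rw [hΦ]
    exact orbital_comp_swap01_eq L α w hα hreal hcpt ν Θ z
  set W : Set (Fin 3 → ℝ) := {θ : Fin 3 → ℝ | ζ * Circle.exp (θ 0) ≠ ζ * Circle.exp (θ 2) ∧ ζ * Circle.exp (θ 1) ≠ ζ * Circle.exp (θ 2)} with hWdef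
  have hW : IsOpen W := isOpen_setOf_off_noncompact_walls ζ
  have hΦW : ContDiffOn ℝ 3 (fun θ : Fin 3 → ℝ => Φ (fun j => ζ * Circle.exp (θ j))) W := by
    rw [hΦ]
    exact (contDiffOn_orbital_angleChart_off_noncompact_walls L α w hα hreal hcpt ν Θ hΘ hΘc ζ).of_le
      (by exact_mod_cast ENat.natCast_le_of_coe_top_le_withTop le_rfl 3)
  -- the region of agreement `S = U ∩ C` and the wall facts
  have hS : IsOpen (U ∩ C) := hU.inter hC
  have hHF' : EqOn H (fun θ : Fin 3 → ℝ =>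
      (((ζ * Circle.exp (θ 0) : Circle) : ℂ)) * ((((ζ * Circle.exp (θ 2) : Circle) : ℂ)))⁻¹ *
        ((1 - (((ζ * Circle.exp (θ 1) : Circle) : ℂ)) * ((((ζ * Circle.exp (θ 0) : Circle) : ℂ)))⁻¹) *
          (1 - (((ζ * Circle.exp (θ 2) : Circle) : ℂ)) * ((((ζ * Circle.exp (θ 1) : Circle) : ℂ)))⁻¹) *
          (1 - (((ζ * Circle.exp (θ 2) : Circle) : ℂ)) * ((((ζ * Circle.exp (θ 0) : Circle) : ℂ)))⁻¹)) *
        Φ (fun j => ζ * Circle.exp (θ j))) (U ∩ C) := fun θ hθ => hHF θ hθ.1 hθ.2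
  have hwall' : ∀ t ∈ Ioo 0 δ, t • (![1, 1, -2] : Fin 3 → ℝ) ∈ U ∧ t • (![1, 1, -2] : Fin 3 → ℝ) ∈ W ∧
      t • (![1, 1, -2] : Fin 3 → ℝ) ∈ closure (U ∩ C) := by
    intro t ht
    obtain ⟨htU, htC⟩ := hwall t ht
    have hoff := wallPoint_off_noncompact_walls ζ (ne_of_gt ht.1) (by rw [abs_of_pos ht.1]; linarith [ht.2])
    exact ⟨htU, hoff, mem_closure_inter_of_isOpen hU htU htC⟩
  exact lambda8Angle_cornerExtension_eq_of_compactWallGerms Φ hΦsymm ζ hW hΦW hS hU h0 hH hHF' hδ hwall' hψ hχ hψdef hχdef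

/-- **THE COMPACT-WALL REDUCTION AT THE ORBITAL INTEGRAL, side `t < 0`** (chambers `{θ₀<θ₁<θ₂}`, `{θ₁<θ₀<θ₂}`): as above with the wall
points `(−u)·A⃗`, `u ∈ (0, δ)`, and the germs `ψ(u) = m(u)·Φ(k_{−u})`, `χ(u) = m(u)²·N²Φ(k_{−u})`. [cite: Rogawski1990, §8.4 pp. 126–127] -/
theorem lambda8Angle_cornerExtension_eq_of_orbital_compactWallGerms_neg (hα : ∀ i, α i ≠ 0) (hreal : ∀ i, (w.1.embedding (α i)).im = 0)
    (hcpt : 0 < (w.1.embedding (α 0)).re * (w.1.embedding (α 1)).re)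
    (ν : Measure (archLocal L 3 (Matrix.diagonal α) w)) [IsFiniteMeasureOnCompacts ν] [ν.IsMulRightInvariant]
    (Θ : Matrix (Fin 3) (Fin 3) ℂ → ℂ) (hΘ : ContDiff ℝ ∞ Θ)
    (hΘc : HasCompactSupport fun k : archLocal L 3 (Matrix.diagonal α) w => Θ ((k : GL (Fin 3) ℂ) : Matrix (Fin 3) (Fin 3) ℂ))
    (ζ : Circle) (Φ : (Fin 3 → Circle) → ℂ)
    (hΦ : Φ = fun z => ∫ g, Θ (((g * ⟨circleDiagonal 3 z, circleDiagonal_mem_archLocal_diagonal L 3 α w z⟩ * g⁻¹ :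
        archLocal L 3 (Matrix.diagonal α) w) : GL (Fin 3) ℂ) : Matrix (Fin 3) (Fin 3) ℂ) ∂ν)
    {C U : Set (Fin 3 → ℝ)} (hC : IsOpen C) (hU : IsOpen U) (h0 : (0 : Fin 3 → ℝ) ∈ U)
    {H : (Fin 3 → ℝ) → ℂ} (hH : ContDiffOn ℝ 3 H U)
    (hHF : ∀ θ ∈ U, θ ∈ C → H θ =
      (((ζ * Circle.exp (θ 0) : Circle) : ℂ)) * ((((ζ * Circle.exp (θ 2) : Circle) : ℂ)))⁻¹ *
        ((1 - (((ζ * Circle.exp (θ 1) : Circle) : ℂ)) * ((((ζ * Circle.exp (θ 0) : Circle) : ℂ)))⁻¹) *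
          (1 - (((ζ * Circle.exp (θ 2) : Circle) : ℂ)) * ((((ζ * Circle.exp (θ 1) : Circle) : ℂ)))⁻¹) *
          (1 - (((ζ * Circle.exp (θ 2) : Circle) : ℂ)) * ((((ζ * Circle.exp (θ 0) : Circle) : ℂ)))⁻¹)) *
        Φ (fun j => ζ * Circle.exp (θ j)))
    {δ : ℝ} (hδ : 0 < δ) (hδ2 : δ ≤ 2)
    (hwall : ∀ u ∈ Ioo 0 δ, (-u) • (![1, 1, -2] : Fin 3 → ℝ) ∈ U ∧ (-u) • (![1, 1, -2] : Fin 3 → ℝ) ∈ closure C)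
    {ψ χ : ℝ → ℂ} (hψ : ContDiffOn ℝ 2 ψ (Icc 0 δ)) (hχ : ContDiffOn ℝ 2 χ (Icc 0 δ))
    (hψdef : ∀ u ∈ Ioo 0 δ, ψ u = ((2 - 2 * Real.cos (3 * u) : ℝ) : ℂ) * Φ (fun j => ζ * Circle.exp (((-u) • (![1, 1, -2] : Fin 3 → ℝ)) j)))
    (hχdef : ∀ u ∈ Ioo 0 δ, χ u = ((2 - 2 * Real.cos (3 * u) : ℝ) : ℂ) ^ 2 *
      iteratedDeriv 2 (fun s : ℝ => Φ (fun j => (fun i : Fin 3 => ζ * Circle.exp (((-u) • (![1, 1, -2] : Fin 3 → ℝ)) i)) j *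
        Circle.exp (s * (![1, -1, 0] : Fin 3 → ℝ) j))) 0) :
    (1 / 48 : ℂ) * ∑ ε : Fin 3 → Bool, ((((if ε 0 then (1 : ℝ) else -1) * (if ε 1 then (1 : ℝ) else -1) * (if ε 2 then (1 : ℝ) else -1) : ℝ)) : ℂ) *
        iteratedDeriv 3 (fun s : ℝ => H (s • (![(if ε 0 then (1 : ℝ) else -1) + (if ε 1 then (1 : ℝ) else -1), -(if ε 0 then (1 : ℝ) else -1) + (if ε 2 then (1 : ℝ) else -1),
          -(if ε 1 then (1 : ℝ) else -1) - (if ε 2 then (1 : ℝ) else -1)]))) 0 =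
        -(2 / 3) * I * iteratedDerivWithin 2 ψ (Icc 0 δ) 0 - (1 / 2) * I * ψ 0 + (1 / 12) * I * iteratedDerivWithin 2 χ (Icc 0 δ) 0 ∧
      12 * ψ 0 = 6 * χ 0 ∧ 12 * derivWithin ψ (Icc 0 δ) 0 = 6 * derivWithin χ (Icc 0 δ) 0 := by
  have hΦsymm : ∀ z : Fin 3 → Circle, Φ (z ∘ (Equiv.swap (0 : Fin 3) 1)) = Φ z := by
    intro z
    rw [hΦ]
    exact orbital_comp_swap01_eq L α w hα hreal hcpt ν Θ z
  set W : Set (Fin 3 → ℝ) := {θ : Fin 3 → ℝ | ζ * Circle.exp (θ 0) ≠ ζ * Circle.exp (θ 2) ∧ ζ * Circle.exp (θ 1) ≠ ζ * Circle.exp (θ 2)} with hWdef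
  have hW : IsOpen W := isOpen_setOf_off_noncompact_walls ζ
  have hΦW : ContDiffOn ℝ 3 (fun θ : Fin 3 → ℝ => Φ (fun j => ζ * Circle.exp (θ j))) W := by
    rw [hΦ]
    exact (contDiffOn_orbital_angleChart_off_noncompact_walls L α w hα hreal hcpt ν Θ hΘ hΘc ζ).of_le
      (by exact_mod_cast ENat.natCast_le_of_coe_top_le_withTop le_rfl 3)
  have hS : IsOpen (U ∩ C) := hU.inter hC
  have hHF' : EqOn H (fun θ : Fin 3 → ℝ =>
      (((ζ * Circle.exp (θ 0) : Circle) : ℂ)) * ((((ζ * Circle.exp (θ 2) : Circle) : ℂ)))⁻¹ *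
        ((1 - (((ζ * Circle.exp (θ 1) : Circle) : ℂ)) * ((((ζ * Circle.exp (θ 0) : Circle) : ℂ)))⁻¹) *
          (1 - (((ζ * Circle.exp (θ 2) : Circle) : ℂ)) * ((((ζ * Circle.exp (θ 1) : Circle) : ℂ)))⁻¹) *
          (1 - (((ζ * Circle.exp (θ 2) : Circle) : ℂ)) * ((((ζ * Circle.exp (θ 0) : Circle) : ℂ)))⁻¹)) *
        Φ (fun j => ζ * Circle.exp (θ j))) (U ∩ C) := fun θ hθ => hHF θ hθ.1 hθ.2
  have hwall' : ∀ u ∈ Ioo 0 δ, (-u) • (![1, 1, -2] : Fin 3 → ℝ) ∈ U ∧ (-u) • (![1, 1, -2] : Fin 3 → ℝ) ∈ W ∧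
      (-u) • (![1, 1, -2] : Fin 3 → ℝ) ∈ closure (U ∩ C) := by
    intro u hu
    obtain ⟨huU, huC⟩ := hwall u hu
    have hoff := wallPoint_off_noncompact_walls ζ (neg_ne_zero.2 (ne_of_gt hu.1)) (by rw [abs_neg, abs_of_pos hu.1]; linarith [hu.2])
    exact ⟨huU, hoff, mem_closure_inter_of_isOpen hU huU huC⟩
  exact lambda8Angle_cornerExtension_eq_of_compactWallGerms_neg Φ hΦsymm ζ hW hΦW hS hU h0 hH hHF' hδ hwall' hψ hχ hψdef hχdef

end Main

end Literature.NumberTheory.Rogawski1990
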